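import Summits.Parity.BatemanHorn.Theses.RoughValueTransport
import Summits.Parity.BatemanHorn.Theorems.RoughValueTransportRoughValueLawSingularSeriesFactorisationEuler
import Summits.Parity.BatemanHorn.Theorems.RoughValueTransportRoughValueLawSingularSeriesFactorisationJoint
import Literature.NumberTheory.Sieve.PolynomialCongruencesLemmas
import Literature.NumberTheory.Sieve.BatemanHornMertensProduct
import Literature.NumberTheory.LFunctions.PolynomialRootMoebiusDirichlet
import HarnessLib

/-!
# Route RoughValueTransport, crux RoughValueLaw (stmt-Parity-11390), line friable-deep-tail
## The registered stub `stub_singularSeriesFactorisation` (S2b₂β)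

This is a `--supports` file of the checked skeleton of the line `friable-deep-tail` (v7): it proves
the registered stub `stub_singularSeriesFactorisation` verbatim (part 3 of 3; parts 1–2 are the
registered helper sub-goals `stub_singularSeriesFactorisation_euler` / `_joint`).

For a Bateman–Horn system `f = (f₀, …, f_{k-1})` let
`A_f(n) = Σ_{d : dᵢ ∣ n, ∏ dᵢ = n} (∏ μ(dᵢ)) · #{r < n : ∀ i, dᵢ ∣ fᵢ(r)}` (joint root counts) and
`B_f = ∏ᵢ μρ_{fᵢ}` (Dirichlet product of the single-polynomial functions `m ↦ μ(m)ρ_{fᵢ}(m)`).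
Then `A_f = B_f ⋆ E` with `Σ_m |E(m)|/m < ∞`.

Proof.  §1: the completely multiplicative `cρ_g = (n ↦ ∏_{p^m ‖ n} ρ_g(p)^m)` (`cρ_g(p) = ρ_g(p)`)
is the Dirichlet inverse of `μρ_g = (m ↦ μ(m)ρ_g(m))` (`moebiusRootCount_mul_rootPow`; both are
written over Mathlib's `toArithmeticFunction`, no new definitions; the real-valued analogue of the
tree's complex `μρ[g]` of `PolynomialRootMoebiusDirichlet`, whose `polyRootCountMod_single_one` we
reuse).  §2: `E := A_f ⋆ ∏ᵢ cρ_{fᵢ}`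
gives `B_f ⋆ E = A_f ⋆ ∏ᵢ (μρ_{fᵢ} ⋆ cρ_{fᵢ}) = A_f`, the displayed identity
(`ArithmeticFunction.mul_apply`).  Summability is the criterion of part 1
(`summable_abs_mul_div_of_local`) fed with part 2: `A_f` is multiplicative (CRT),
`A_f(p) = -Σᵢ ρᵢ(p) = -(∏ cρᵢ)(p)`, `A_f(p^i) = 0` for `i > k`, and for `i ≥ 2` beyond the finitely
many primes modulo which two members have a common root (resultants); and
`(∏ᵢ cρᵢ)(p^m) ≤ (m+1)^k G_p^m` with `G_p = min(ω_f(p), Σ deg fᵢ)`, where `ρᵢ(p) ≤ ω_f(p) < p`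
(`hasNoFixedPrimeDivisor`) and `ρᵢ(p) ≤ deg fᵢ` (Lagrange; tree
`BatemanHornMertens.rootCount_single_le_natDegree`).  Hypotheses of `IsBatemanHornSystem` used:
`irreducible`, `pairwise_not_associated`, `hasNoFixedPrimeDivisor` (`leadingCoeff_pos` only
through the tree lemma just quoted).  No named facts.
-/

noncomputable section

open Filter Finset Polynomial
open scoped Topology BigOperators

namespace Summit.Parity.BatemanHorn.Cruxes.RoughValueLaw.FriableDeepTail

open Literature.NumberTheory.Sieve

namespace SingularSeriesFactorisation

/-! ### §1 `μρ_g` and its Dirichlet inverse `cρ_g` -/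

section Single

variable (g : ℤ[X])

/-- Unfolding lemma: `μρ_g(n) = μ(n)ρ_g(n)` (also at `n = 0`). [folklore] -/
theorem moebiusRootCount_apply (n : ℕ) :
    toArithmeticFunction (fun m : ℕ =>
      (ArithmeticFunction.moebius m : ℝ) * (polyRootCountMod ![g] m : ℝ)) n =
      (ArithmeticFunction.moebius n : ℝ) * (polyRootCountMod ![g] n : ℝ) := by
  rcases eq_or_ne n 0 with rfl | hn
  · simp [toArithmeticFunction]
  · simp [toArithmeticFunction, hn]

/-- `μρ_g` is multiplicative (`μ` and `ρ_g` are). [folklore] -/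
theorem isMultiplicative_moebiusRootCount :
    (toArithmeticFunction (fun m : ℕ =>
      (ArithmeticFunction.moebius m : ℝ) * (polyRootCountMod ![g] m : ℝ))).IsMultiplicative := by
  refine ⟨?_, ?_⟩
  · simp [moebiusRootCount_apply, Literature.NumberTheory.LFunctions.polyRootCountMod_single_one]
  · intro m n hmn
    simp only [moebiusRootCount_apply]
    rw [ArithmeticFunction.isMultiplicative_moebius.map_mul_of_coprime hmn,
      polyRootCountMod_mul_of_coprime g hmn]
    push_cast
    ring

/-- Unfolding lemma (off `0`): `cρ_g(n) = ∏_{p^m ‖ n} ρ_g(p)^m`. [folklore] -/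
theorem rootPow_apply {n : ℕ} (hn : n ≠ 0) :
    toArithmeticFunction (fun n : ℕ =>
      (Finsupp.prod (Nat.factorization n) fun p m => (polyRootCountMod ![g] p : ℝ) ^ m)) n =
      n.factorization.prod fun p m => (polyRootCountMod ![g] p : ℝ) ^ m := by
  simp [toArithmeticFunction, hn]

/-- `cρ_g ≥ 0`. [folklore] -/
theorem rootPow_nonneg (n : ℕ) :
    0 ≤ toArithmeticFunction (fun n : ℕ =>
      (Finsupp.prod (Nat.factorization n) fun p m => (polyRootCountMod ![g] p : ℝ) ^ m)) n := by
  rcases eq_or_ne n 0 with rfl | hn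
  · simp [toArithmeticFunction]
  · rw [rootPow_apply g hn]
    exact Finset.prod_nonneg fun p _ => by positivity

/-- `cρ_g(p^m) = ρ_g(p)^m`. [folklore] -/
theorem rootPow_prime_pow {p : ℕ} (hp : p.Prime) (m : ℕ) :
    toArithmeticFunction (fun n : ℕ =>
      (Finsupp.prod (Nat.factorization n) fun p m => (polyRootCountMod ![g] p : ℝ) ^ m)) (p ^ m) =
      (polyRootCountMod ![g] p : ℝ) ^ m := by
  rw [rootPow_apply g (pow_ne_zero m hp.ne_zero), hp.factorization_pow, Finsupp.prod_single_index]
  exact pow_zero _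

/-- `cρ_g(p) = ρ_g(p)`. [folklore] -/
theorem rootPow_prime {p : ℕ} (hp : p.Prime) :
    toArithmeticFunction (fun n : ℕ =>
      (Finsupp.prod (Nat.factorization n) fun p m => (polyRootCountMod ![g] p : ℝ) ^ m)) p =
      (polyRootCountMod ![g] p : ℝ) := by
  simpa using rootPow_prime_pow g hp 1

/-- `cρ_g` is multiplicative (indeed completely multiplicative off `0`). [folklore] -/
theorem isMultiplicative_rootPow :
    (toArithmeticFunction (fun n : ℕ =>
      (Finsupp.prod (Nat.factorization n) fun p m => (polyRootCountMod ![g] p : ℝ) ^ m))).IsMultiplicative := by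
  refine ArithmeticFunction.IsMultiplicative.iff_ne_zero.mpr ⟨?_, ?_⟩
  · rw [rootPow_apply g one_ne_zero, Nat.factorization_one, Finsupp.prod_zero_index]
  · intro m n hm hn _
    rw [rootPow_apply g (Nat.mul_ne_zero hm hn), rootPow_apply g hm, rootPow_apply g hn,
      Nat.factorization_mul hm hn, Finsupp.prod_add_index']
    · intro p
      exact pow_zero _
    · intro p a b
      exact pow_add _ _ _

/-- **`cρ_g` is the Dirichlet inverse of `μρ_g`**: both are multiplicative, and at `p^j`, `j ≥ 1`,
`(μρ_g ⋆ cρ_g)(p^j) = ρ^j − ρ·ρ^{j-1} = 0`. [folklore] -/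
theorem moebiusRootCount_mul_rootPow :
    toArithmeticFunction (fun m : ℕ =>
      (ArithmeticFunction.moebius m : ℝ) * (polyRootCountMod ![g] m : ℝ)) *
        toArithmeticFunction (fun n : ℕ =>
      (Finsupp.prod (Nat.factorization n) fun p m => (polyRootCountMod ![g] p : ℝ) ^ m)) = 1 := by
  refine (ArithmeticFunction.IsMultiplicative.eq_iff_eq_on_prime_powers _
    ((isMultiplicative_moebiusRootCount g).mul (isMultiplicative_rootPow g)) _
    ArithmeticFunction.isMultiplicative_one).mpr ?_
  intro p j hp
  rw [mul_apply_prime_pow _ _ hp, ArithmeticFunction.one_apply]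
  rcases Nat.eq_zero_or_pos j with rfl | hj
  · simp [moebiusRootCount_apply, Literature.NumberTheory.LFunctions.polyRootCountMod_single_one,
      (isMultiplicative_rootPow g).map_one]
  · obtain ⟨j, rfl⟩ : ∃ j', j = j' + 1 := ⟨j - 1, by omega⟩
    rw [if_neg (ne_of_gt (Nat.one_lt_pow (Nat.succ_ne_zero j) hp.one_lt)),
      sum_range_succ', sum_range_succ', sum_eq_zero (fun i _ => ?_)]
    · have e1 : j + 1 - (0 + 1) = j := by omega
      rw [e1]
      simp only [zero_add, pow_zero, pow_one, Nat.sub_zero, moebiusRootCount_apply,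
        rootPow_prime_pow g hp, ArithmeticFunction.moebius_apply_prime hp,
        ArithmeticFunction.moebius_apply_one,
        Literature.NumberTheory.LFunctions.polyRootCountMod_single_one]
      push_cast
      ring
    · rw [moebiusRootCount_apply,
        ArithmeticFunction.moebius_apply_prime_pow hp (Nat.succ_ne_zero (i + 1)),
        if_neg (by omega)]
      simp

end Single

end SingularSeriesFactorisation

open SingularSeriesFactorisation

/-! ### §2 The stub -/

/-- **S2b₂β — SingularSeriesFactorisation (the registered stub, v7).**  For a Bateman–Horn system
`f`, the joint-root-count coefficient `A_f` factors as `(∏ᵢ μρ_{fᵢ}) ⋆ E` with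
`Σ_m |E(m)|/m < ∞`; here `E = A_f ⋆ ∏ᵢ cρ_{fᵢ}`. [folklore] -/
theorem stub_singularSeriesFactorisation :
    ∀ (k : ℕ) (f : Fin k → ℤ[X]), IsBatemanHornSystem f →
      ∃ E : ℕ → ℝ, Summable (fun m : ℕ => |E m| / m) ∧
        ∀ n : ℕ, (∑ d ∈ (Fintype.piFinset fun _ : Fin k => n.divisors) with (∏ i, d i) = n,
            (∏ i, (ArithmeticFunction.moebius (d i) : ℝ)) *
              ((#((range n).filter
                  (fun r : ℕ => ∀ i, ((d i : ℕ) : ℤ) ∣ (f i).eval (r : ℤ))) : ℕ) : ℝ)) =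
          ∑ p ∈ n.divisorsAntidiagonal,
            (∏ i, toArithmeticFunction (fun m : ℕ => (ArithmeticFunction.moebius m : ℝ) *
                (polyRootCountMod ![f i] m : ℝ))) p.1 * E p.2 := by
  intro k f hf
  -- `E := A_f ⋆ ∏ᵢ cρ_{fᵢ}`
  refine ⟨⇑(toArithmeticFunction (fun n : ℕ =>
        ∑ d ∈ (Fintype.piFinset fun _ : Fin k => n.divisors) with (∏ i, d i) = n,
          (∏ i, (ArithmeticFunction.moebius (d i) : ℝ)) *
            ((#((range n).filter
                (fun r : ℕ => ∀ i, ((d i : ℕ) : ℤ) ∣ (f i).eval (r : ℤ))) : ℕ) : ℝ)) *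
      ∏ i : Fin k, toArithmeticFunction (fun n : ℕ =>
          (Finsupp.prod (Nat.factorization n) fun p m => (polyRootCountMod ![f i] p : ℝ) ^ m))), ?_, ?_⟩
  · -- summability: the criterion of part 1 with the arithmetic of part 2 and §1
    obtain ⟨P₀, hP₀⟩ :=
      exists_forall_not_common_root f hf.irreducible hf.pairwise_not_associated
    have hcmult := fun i (_ : i ∈ (univ : Finset (Fin k))) => isMultiplicative_rootPow (f i)
    have hc0 := fun i (_ : i ∈ (univ : Finset (Fin k))) (n : ℕ) => rootPow_nonneg (f i) n
    refine summable_abs_mul_div_of_local (k := k) (P₀ := P₀)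
      (D := ((∑ i, (f i).natDegree : ℕ) : ℝ))
      (isMultiplicative_jointCoeff f)
      (ArithmeticFunction.isMultiplicative_finsetProd _ _ hcmult)
      (finsetProd_apply_nonneg _ _ hc0) ?_ ?_ ?_ ?_
    · intro p hp
      rw [jointCoeff_prime f hp, finsetProd_apply_prime _ _ hcmult hp]
      simp only [rootPow_prime _ hp]
      ring
    · exact fun p hp i hi => jointCoeff_prime_pow_eq_zero_of_lt f hp hi
    · exact fun p hp hP i hi => jointCoeff_prime_pow_eq_zero_of_forall f hp hi (hP₀ p hp hP)
    · intro p hp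
      set D : ℝ := ((∑ i, (f i).natDegree : ℕ) : ℝ) with hD
      set G : ℝ := min (polyRootCountMod f p : ℝ) D with hG
      have hρG : ∀ i, (polyRootCountMod ![f i] p : ℝ) ≤ G := fun i =>
        le_min (by exact_mod_cast BatemanHornMertens.polyRootCountMod_single_le f i p)
          (by
            rw [hD]
            exact_mod_cast (BatemanHornMertens.rootCount_single_le_natDegree hf i hp).trans
              (single_le_sum (f := fun j => (f j).natDegree) (fun _ _ => Nat.zero_le _)
                (mem_univ i)))
      have hD0 : 0 ≤ D := by
        rw [hD]
        exact Nat.cast_nonneg _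
      have hG0 : 0 ≤ G := le_min (Nat.cast_nonneg _) hD0
      refine ⟨G, hG0, min_le_right _ _, ?_, fun m => ?_⟩
      · have h1 : ((polyRootCountMod f p : ℕ) : ℝ) + 1 ≤ p := by
          exact_mod_cast hf.hasNoFixedPrimeDivisor p hp
        linarith [min_le_left (polyRootCountMod f p : ℝ) D]
      · have h := finsetProd_apply_prime_pow_le _ univ hc0 hp (G := G) hG0 (fun i _ m => ?_) m
        · rwa [card_univ, Fintype.card_fin] at h
        · rw [rootPow_prime_pow _ hp]
          exact pow_le_pow_left₀ (Nat.cast_nonneg _) (hρG i) m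
  · -- the identity `B ⋆ E = A ⋆ (B ⋆ C) = A` at `n`
    intro n
    have hBC : (∏ i : Fin k, toArithmeticFunction (fun m : ℕ =>
        (ArithmeticFunction.moebius m : ℝ) * (polyRootCountMod ![f i] m : ℝ))) *
        (∏ i : Fin k, toArithmeticFunction (fun n : ℕ =>
          (Finsupp.prod (Nat.factorization n) fun p m => (polyRootCountMod ![f i] p : ℝ) ^ m))) = 1 := by
      rw [← prod_mul_distrib]
      exact prod_eq_one fun i _ => moebiusRootCount_mul_rootPow (f i)
    rw [← ArithmeticFunction.mul_apply, mul_left_comm, hBC, mul_one, jointCoeff_apply f n]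

end Summit.Parity.BatemanHorn.Cruxes.RoughValueLaw.FriableDeepTail

end
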